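import Summits.QuantumFields.BalabanUV.T4Continuum.Support.NE7K1LinHomKernel

/-!
# NE7K1LinHomGramSums — row NE7 (node U5), candidate route HOM, path H1L, cell K1-lin(s): the interpolation kernel's PROFILE SQUARE
# SUMS in closed form (Faulhaber to degree four): `A = Σ_j ℓ_j² = (2L²−3)(L²−1)∕(15L³)`, `B = Σ_j ℓ_j r_j = −(L²−1)(L²+6)∕(30L³)`

Lineage `b2b-balaban-t4-ne7-p2` (CRUX PROVER NE7 #2), generation 66 (eighth file; first of the GRAM sharpening of the L-uniform
two-run constant).  The Schur test of `NE7K1LinHomUpper` charges the transverse kernels their absolute row × column sums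
`ρ₀ρ₁ = 5∕2` per direction; the Gram matrix `Σ_t k̃(t,Y)k̃(t,Z)` of the kernel has absolute row sums `L + 2A + B ≤ (37∕30)L`
(next file), which needs `A` and `B` exactly.  All [folklore]:

* `sum_P_sq`, `sum_P_mul_P_refl`: `Σ_{j<m} P(L,j)²` and `Σ_{j<m} P(L,j)P(L,L−1−j)` for the numerator `P(L,x) = L² − 2L(2x+1) + 3x(x+1) + 1`
  as polynomials in `(L, m)` (induction on `m`, `ring`); at `m = L`: **`sum_shapeL_sq`** `A = (2L²−3)(L²−1)∕(15L³)`,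
  **`sum_shapeL_mul_shapeR`** `B = −(L²−1)(L²+6)∕(30L³)`, `sum_shapeR_sq = A`.
* signs: `A ≥ 0`, `B ≤ 0`, `A + B = ½Σ(ℓ+r)² ≥ 0`; **`gram_row_const_le`**: `L + 2A + B = (74L⁴ − 50L² + 36)∕(60L³) ≤ (37∕30)L`.

HONEST FRAMING: Gaussian `A = 0`, finite boxes, finite real matrices, [folklore]; ONE RG step in `U = 1` gauge; a census ∕
NEEDS-CONSTANT sharpening of the L-uniform upper two-run constant of `NE7K1LinHomUpper` (`5·(5∕2)^d ↦ 5·(37∕30)^d`), no letter ∕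
tag ∕ size of NE7 moves; nothing printed asserted; no `sorry`.  FIXED FINITE T⁴, rung (B)+1; NE7 NOT PRINTED ∕ NOT PROVED; spine 0∕9;
NOT infinite volume, NOT mass gap, NOT Clay.  HONEST DEPENDENCY: continuum YM on T⁴ ⇐ BetaPertH ∧ nine spine estimates (0/9 proved);
BetaPertH ⇐ (D1) ∧ (D4) ∧ CAP+tail; G-an2-4 gates asym, D1 and NE2/3/4.
-/

noncomputable section

open Finset

namespace Summit.QuantumFields.BalabanUV.T4Continuum.NE7K1LinHomGramSums

open NE7K1LinHomKernel

/-! ### §1 Faulhaber to degree four: the profile square sums in closed form -/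

/-- the numerator polynomial of the shape: `P(L, x) = L² − 2L(2x+1) + 3x(x+1) + 1`, so `ℓ_j = P(L,j)∕L²`. [folklore] -/
theorem shapeL_eq_div (L : ℕ) (j : ℤ) :
    shapeL L j = (((L : ℝ) ^ 2 - 2 * L * (2 * j + 1) + 3 * j * (j + 1) + 1)) / (L : ℝ) ^ 2 := rfl

/-- `Σ_{j<m} P(L,j)²` in closed form (induction on `m`). [folklore] -/
theorem sum_P_sq (L : ℝ) (m : ℕ) :
    ∑ j ∈ range m, (L ^ 2 - 2 * L * (2 * (j : ℝ) + 1) + 3 * (j : ℝ) * (j + 1) + 1) ^ 2 =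
      (m : ℝ) / 5 - (m : ℝ) ^ 3 + 9 / 5 * (m : ℝ) ^ 5 + 2 * L * (m : ℝ) ^ 2 - 6 * L * (m : ℝ) ^ 4 - 4 / 3 * L ^ 2 * m +
        22 / 3 * L ^ 2 * (m : ℝ) ^ 3 - 4 * L ^ 3 * (m : ℝ) ^ 2 + L ^ 4 * m := by
  induction m with
  | zero => simp
  | succ m ih => rw [Finset.sum_range_succ, ih]; push_cast; ring

/-- `Σ_{j<m} P(L,j)·P(L,L−1−j)` in closed form (induction on `m`). [folklore] -/
theorem sum_P_mul_P_refl (L : ℝ) (m : ℕ) :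
    ∑ j ∈ range m, (L ^ 2 - 2 * L * (2 * (j : ℝ) + 1) + 3 * (j : ℝ) * (j + 1) + 1) *
        (L ^ 2 - 2 * L * (2 * (L - 1 - j) + 1) + 3 * (L - 1 - (j : ℝ)) * (L - 1 - j + 1) + 1) =
      (m : ℝ) / 5 - (m : ℝ) ^ 3 + 9 / 5 * (m : ℝ) ^ 5 + 3 / 2 * L * (m : ℝ) ^ 2 - 9 / 2 * L * (m : ℝ) ^ 4 -
        2 / 3 * L ^ 2 * m + 11 / 3 * L ^ 2 * (m : ℝ) ^ 3 - L ^ 3 * (m : ℝ) ^ 2 := by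
  induction m with
  | zero => simp
  | succ m ih => rw [Finset.sum_range_succ, ih]; push_cast; ring

/-- **`A := Σ_{j<L} ℓ_j² = (2L²−3)(L²−1)∕(15L³)`**. [folklore] -/
theorem sum_shapeL_sq {L : ℕ} (hL : 1 ≤ L) :
    ∑ j ∈ range L, shapeL L (j : ℤ) ^ 2 = (2 * (L : ℝ) ^ 2 - 3) * ((L : ℝ) ^ 2 - 1) / (15 * (L : ℝ) ^ 3) := by
  have hL0 : (L : ℝ) ≠ 0 := Nat.cast_ne_zero.2 (by omega)
  have h : ∀ j ∈ range L, shapeL L (j : ℤ) ^ 2 =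
      ((L : ℝ) ^ 2 - 2 * L * (2 * (j : ℝ) + 1) + 3 * (j : ℝ) * (j + 1) + 1) ^ 2 / (L : ℝ) ^ 4 := by
    intro j _
    rw [shapeL_eq_div]; push_cast; rw [div_pow]; ring
  rw [Finset.sum_congr rfl h, ← Finset.sum_div, sum_P_sq]
  field_simp
  ring

/-- **`B := Σ_{j<L} ℓ_j r_j = −(L²−1)(L²+6)∕(30L³)`**. [folklore] -/
theorem sum_shapeL_mul_shapeR {L : ℕ} (hL : 1 ≤ L) :
    ∑ j ∈ range L, shapeL L (j : ℤ) * shapeR L (j : ℤ) = -(((L : ℝ) ^ 2 - 1) * ((L : ℝ) ^ 2 + 6)) / (30 * (L : ℝ) ^ 3) := by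
  have hL0 : (L : ℝ) ≠ 0 := Nat.cast_ne_zero.2 (by omega)
  have h : ∀ j ∈ range L, shapeL L (j : ℤ) * shapeR L (j : ℤ) =
      ((L : ℝ) ^ 2 - 2 * L * (2 * (j : ℝ) + 1) + 3 * (j : ℝ) * (j + 1) + 1) *
        ((L : ℝ) ^ 2 - 2 * L * (2 * ((L : ℝ) - 1 - j) + 1) + 3 * ((L : ℝ) - 1 - (j : ℝ)) * ((L : ℝ) - 1 - j + 1) + 1) /
        (L : ℝ) ^ 4 := by
    intro j _
    rw [shapeR, shapeL_eq_div, shapeL_eq_div]; push_cast; field_simp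
  rw [Finset.sum_congr rfl h, ← Finset.sum_div, sum_P_mul_P_refl]
  field_simp
  ring


/-- `Σ_{j<L} r_j² = Σ_{j<L} ℓ_j²`. [folklore] -/
theorem sum_shapeR_sq (L : ℕ) : ∑ j ∈ range L, shapeR L (j : ℤ) ^ 2 = ∑ j ∈ range L, shapeL L (j : ℤ) ^ 2 := by
  have h : ∀ j ∈ range L, shapeR L (j : ℤ) ^ 2 = shapeL L ((L - 1 - j : ℕ) : ℤ) ^ 2 := by
    intro j hj
    rw [Finset.mem_range] at hj
    unfold shapeR
    congr 2
    omega
  rw [Finset.sum_congr rfl h, Finset.sum_range_reflect (fun j => shapeL L (j : ℤ) ^ 2) L]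

section Signs

variable {L : ℕ}

/-- `A ≥ 0`. [folklore] -/
theorem sumA_nonneg (L : ℕ) : 0 ≤ ∑ j ∈ range L, shapeL L (j : ℤ) ^ 2 := Finset.sum_nonneg fun _ _ => sq_nonneg _

/-- `B ≤ 0`. [folklore] -/
theorem sumB_nonpos (hL : 1 ≤ L) : ∑ j ∈ range L, shapeL L (j : ℤ) * shapeR L (j : ℤ) ≤ 0 := by
  rw [sum_shapeL_mul_shapeR hL]
  have hL1 : (1 : ℝ) ≤ L := by exact_mod_cast hL
  have hsq : (0 : ℝ) ≤ (L : ℝ) ^ 2 - 1 := by nlinarith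
  have h1 : (0 : ℝ) ≤ ((L : ℝ) ^ 2 - 1) * ((L : ℝ) ^ 2 + 6) := mul_nonneg hsq (by positivity)
  have h2 : (0 : ℝ) < 30 * (L : ℝ) ^ 3 := by positivity
  rw [neg_div]
  exact neg_nonpos.2 (div_nonneg h1 h2.le)

/-- `A + B ≥ 0` (indeed `A + B = ½Σ(ℓ_j + r_j)²`). [folklore] -/
theorem sumA_add_sumB_nonneg (L : ℕ) :
    0 ≤ ∑ j ∈ range L, shapeL L (j : ℤ) ^ 2 + ∑ j ∈ range L, shapeL L (j : ℤ) * shapeR L (j : ℤ) := by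
  have h : ∑ j ∈ range L, shapeL L (j : ℤ) ^ 2 + ∑ j ∈ range L, shapeL L (j : ℤ) * shapeR L (j : ℤ) =
      (∑ j ∈ range L, (shapeL L (j : ℤ) + shapeR L (j : ℤ)) ^ 2) / 2 := by
    have e : ∑ j ∈ range L, (shapeL L (j : ℤ) + shapeR L (j : ℤ)) ^ 2 =
        ∑ j ∈ range L, shapeL L (j : ℤ) ^ 2 + 2 * ∑ j ∈ range L, shapeL L (j : ℤ) * shapeR L (j : ℤ) +
          ∑ j ∈ range L, shapeR L (j : ℤ) ^ 2 := by
      rw [Finset.mul_sum, ← Finset.sum_add_distrib, ← Finset.sum_add_distrib]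
      exact Finset.sum_congr rfl fun j _ => by ring
    rw [e, sum_shapeR_sq]
    ring
  rw [h]
  exact div_nonneg (Finset.sum_nonneg fun _ _ => sq_nonneg _) (by norm_num)

/-- **`L + 2A + B ≤ (37∕30)·L`** (`L + 2A + B = (74L⁴ − 50L² + 36)∕(60L³)`). [folklore] -/
theorem gram_row_const_le (hL : 1 ≤ L) :
    (L : ℝ) + 2 * ∑ j ∈ range L, shapeL L (j : ℤ) ^ 2 + ∑ j ∈ range L, shapeL L (j : ℤ) * shapeR L (j : ℤ) ≤
      37 / 30 * (L : ℝ) := by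
  rw [sum_shapeL_sq hL, sum_shapeL_mul_shapeR hL]
  have hL1 : (1 : ℝ) ≤ L := by exact_mod_cast hL
  have hL3 : (0 : ℝ) < (L : ℝ) ^ 3 := by positivity
  rw [show (L : ℝ) + 2 * ((2 * (L : ℝ) ^ 2 - 3) * ((L : ℝ) ^ 2 - 1) / (15 * (L : ℝ) ^ 3)) +
      -(((L : ℝ) ^ 2 - 1) * ((L : ℝ) ^ 2 + 6)) / (30 * (L : ℝ) ^ 3) =
      (L : ℝ) + (7 * (L : ℝ) ^ 4 - 25 * (L : ℝ) ^ 2 + 18) / (30 * (L : ℝ) ^ 3) by field_simp; ring]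
  have key : (7 * (L : ℝ) ^ 4 - 25 * (L : ℝ) ^ 2 + 18) / (30 * (L : ℝ) ^ 3) ≤ 7 / 30 * L := by
    rw [div_le_iff₀ (by positivity)]
    nlinarith
  linarith

end Signs

end Summit.QuantumFields.BalabanUV.T4Continuum.NE7K1LinHomGramSums
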